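import Summits.ValiantsHypothesis.ValiantsHypothesis.Theorems.MonotoneRestorationOrbitRestorationQPExplicitToPDClass
import Summits.ValiantsHypothesis.ValiantsHypothesis.Theorems.MonotoneRestorationOrbitRestorationQPUniformForm
import Summits.ValiantsHypothesis.ValiantsHypothesis.Theorems.MonotoneRestorationOrbitRestorationQPValueOrbitDivisionAlgebra
import HarnessLib

/-!
# A_∞ reduces to HOMOGENEOUS families (crux `OrbitRestorationQP`, stmt-ValiantsHypothesis-18293, line `depth_three_rung`)

Stub `stub_sigmaPiSigmaValue` (A_∞); namespace
`Summit.ValiantsHypothesis.ValiantsHypothesis.Theorems.OrbitRestorationQPDepthThreeRung.HomogeneousReduction`.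

* `totalDegree_scale_le_one` — scalings of affine forms are affine forms;
* `exists_pdClass_one_homogeneousComponent` — **the `ΣΠΣ` slice is closed under homogeneous components, uniformly**:
  for every `c` there is `c'` with `Hom_k q ∈ PDClass 1 n c'` whenever `q ∈ PDClass 1 n c` (all `n`, `q`, `k`).  Proof:
  extract explicit depth-three data (`exists_explicit_of_pdClassOne`), write `Hom_k q` as a Vandermonde combination of the
  scalings `q(t·x)`, `t = 0, …, deg q` (`ValueOrbitDivision.homogeneousComponent_eq_sum_inv_vandermonde_scale` — the
  algebraic half of Strassen's homogenisation), observe that scaling maps explicit data to explicit data of the same shape,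
  and put the doubly-indexed data back with `pdClass_one_of_explicit`;
* `rename_homogeneousComponent_matrixSymmetric` — homogeneous components of matrix-symmetric polynomials are matrix-symmetric;
* `sigmaPiSigmaValue_iff_homogeneous` — **A_∞ ⟺ A_∞ FOR HOMOGENEOUS POLYNOMIALS** (uniform levelwise form): it suffices to
  restore, with one constant per exponent `c`, the matrix-symmetric HOMOGENEOUS members of `PDClass 1 n c`
  (by `UniformForm.sigmaPiSigmaValue_iff_uniform` and `ValueOrbit.qpOrbitRestorable_finset_sum`).

So a prover of A_∞ may assume the target polynomial homogeneous (and given by explicit `ΣΠΣ` data,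
`ExplicitForm.sigmaPiSigmaValue_iff_explicit'`).  Honest label: a reduction; no stub is closed; VP ≠ VNP is not touched.
[cite: Strassen1973, Satz 1; GuptaKamathKayalSaptharishi2016, §1 eq. (1)]
-/

noncomputable section

open scoped Classical

-- `Summit.ValiantsHypothesis.ValiantsHypothesis.…` is the tree's single-conjunct layout (Sub = Summit).
set_option linter.dupNamespace false

namespace Summit.ValiantsHypothesis.ValiantsHypothesis.Theorems.OrbitRestorationQPDepthThreeRung

namespace HomogeneousReduction

open Literature.Computability.AlgebraicComplexity Literature.Computability.AlgebraicComplexity.DepthReduction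
open MvPolynomial
open Summit.ValiantsHypothesis.ValiantsHypothesis.Theorems

variable {n : ℕ}

/-! ### Scaled affine forms -/

/-- A scaling `ℓ(t·x)` of a polynomial of total degree `≤ 1` has total degree `≤ 1`. [folklore] -/
theorem totalDegree_scale_le_one {σ : Type*} (t : ℂ) {ℓ : MvPolynomial σ ℂ} (hℓ : ℓ.totalDegree ≤ 1) :
    (aeval (fun x : σ => C t * X x) ℓ).totalDegree ≤ 1 := by
  rw [ValueOrbitDivision.scale_eq_sum_homogeneousComponent t ℓ hℓ]
  refine (totalDegree_finsetSum _ _).trans (Finset.sup_le fun j hj => ?_)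
  refine (totalDegree_mul _ _).trans ?_
  rw [totalDegree_C, zero_add]
  exact (homogeneousComponent_isHomogeneous j ℓ).totalDegree_le.trans
    (Nat.lt_succ_iff.mp (Finset.mem_range.mp hj))

/-- Scaling an explicit term: `(C a · Π L)(t·x) = C a · Π (L scaled)`. [folklore] -/
theorem scale_term (t a : ℂ) (L : Multiset (MvPolynomial (Fin n × Fin n) ℂ)) :
    aeval (fun x : Fin n × Fin n => C t * X x) (C a * L.prod) =
      C a * (L.map (aeval (fun x : Fin n × Fin n => C t * X x))).prod := by
  rw [map_mul, algHom_C, algebraMap_eq, map_multiset_prod]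

/-! ### The `ΣΠΣ` slice is closed under homogeneous components -/

/-- **`PDClass 1` IS CLOSED UNDER HOMOGENEOUS COMPONENTS, UNIFORMLY IN THE LEVEL.** [cite: Strassen1973, Satz 1] -/
theorem exists_pdClass_one_homogeneousComponent (c : ℕ) : ∃ c' : ℕ,
    ∀ (n : ℕ) (q : MvPolynomial (Fin n × Fin n) ℂ) (k₀ : ℕ),
      PDClass (fun _ => 1) n c q → PDClass (fun _ => 1) n c' (homogeneousComponent k₀ q) := by
  -- exponents: `c₃` bounds the doubled index set and the factor counts, `c₄` is the output of `pdClass_one_of_explicit`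
  set c₃ := 2 * (2 * c + 5) + 3 ^ (2 * c + 5) with hc₃
  refine ⟨2 * (2 * c₃ + 8) + 3 ^ (2 * c₃ + 8), fun n q k₀ hq => ?_⟩
  -- p-bound arithmetic in `(n+2)`-currency
  set B := n + 2 with hB
  have hB2 : 2 ≤ B := by omega
  have hBpos : ∀ e, 1 ≤ B ^ e := fun e => Nat.one_le_pow _ _ (by omega)
  have hfinal : B ^ (2 * c + 5) ≤ n ^ c₃ + c₃ := by
    have h := vsbr_pow_base_le n (2 * c + 5)
    have h3 : 3 ^ (2 * c + 5) ≤ 2 * (2 * c + 5) + 3 ^ (2 * c + 5) := Nat.le_add_left _ _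
    rcases Nat.eq_zero_or_pos n with hn0 | hn
    · subst hn0
      have e1 : (0 : ℕ) ^ (2 * (2 * c + 5)) = 0 := zero_pow (by omega)
      have e2 : (0 : ℕ) ^ c₃ = 0 := zero_pow (by positivity : 0 < 2 * (2 * c + 5) + 3 ^ (2 * c + 5)).ne'
      rw [e1] at h
      rw [e2]
      exact h.trans (Nat.add_le_add_left h3 0)
    · exact h.trans (Nat.add_le_add (Nat.pow_le_pow_right hn (Nat.le_add_right _ _)) h3)
  have hcc₃ : c + 2 ≤ c₃ := by
    have : 1 ≤ 3 ^ (2 * c + 5) := Nat.one_le_pow _ _ (by norm_num)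
    omega
  -- the trivial case `k₀ > deg q`
  set N := n ^ c + c with hN
  have hdegq : q.totalDegree ≤ N := hq.1
  by_cases hk₀ : N < k₀
  · rw [homogeneousComponent_eq_zero _ _ (lt_of_le_of_lt hdegq hk₀)]
    have h0 := ExplicitForm.pdClass_one_of_explicit (n := n) (c := c₃) (𝒯 := Fin 0) (by simp)
      (fun _ => (0 : ℂ)) (fun _ => (0 : Multiset (MvPolynomial (Fin n × Fin n) ℂ))) (by simp) (by simp)
    simpa using h0
  have hk₀' : k₀ < N + 1 := by omega
  -- explicit data for `q`
  obtain ⟨k, a, L, hdeg, hk, hcard, hq'⟩ := ExplicitForm.exists_explicit_of_pdClassOne hq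
  -- scalings and the Vandermonde combination
  let t : Fin (N + 1) → ℂ := fun i => (i : ℕ)
  have ht : Function.Injective t := fun i j hij => Fin.val_injective (Nat.cast_injective (R := ℂ) hij)
  have hHom := ValueOrbitDivision.homogeneousComponent_eq_sum_inv_vandermonde_scale q hdegq t ht hk₀'
  -- the doubly-indexed explicit data of `Hom_{k₀} q`
  let a' : Fin (N + 1) × Fin k → ℂ := fun p => (Matrix.vandermonde t)⁻¹ ⟨k₀, hk₀'⟩ p.1 * a p.2
  let L' : Fin (N + 1) × Fin k → Multiset (MvPolynomial (Fin n × Fin n) ℂ) := fun p =>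
    (L p.2).map (aeval (fun x : Fin n × Fin n => C (t p.1) * X x))
  have hexp : homogeneousComponent k₀ q = ∑ p : Fin (N + 1) × Fin k, C (a' p) * (L' p).prod := by
    rw [hHom, Fintype.sum_prod_type]
    refine Finset.sum_congr rfl fun s _ => ?_
    conv_lhs => rw [hq', map_sum, Finset.mul_sum]
    refine Finset.sum_congr rfl fun i _ => ?_
    rw [scale_term, ← mul_assoc, ← map_mul]
  rw [hexp]
  refine ExplicitForm.pdClass_one_of_explicit (c := c₃) ?_ a' L' (fun p ℓ hℓ => ?_) (fun p => ?_)
  · -- `#(Fin (N+1) × Fin k) = (N+1) · k ≤ B^(c+2) · B^(c+3) = B^(2c+5) ≤ n^c₃ + c₃`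
    rw [Fintype.card_prod, Fintype.card_fin, Fintype.card_fin]
    have h1 : N + 1 ≤ B ^ (c + 2) := by
      have hp : n ^ c + c ≤ 2 * B ^ c := le_two_mul_pow (le_refl _) (le_refl c)
      calc N + 1 ≤ 2 * B ^ c + B ^ c := Nat.add_le_add hp (hBpos c)
        _ = 3 * B ^ c := by ring
        _ ≤ (B * B) * B ^ c := Nat.mul_le_mul_right _ (by nlinarith)
        _ = B ^ (c + 2) := by ring
    have h2 : k ≤ B ^ (c + 3) := by
      have hp : n ^ (c + 2) + (c + 2) ≤ 2 * B ^ (c + 2) := le_two_mul_pow (le_refl _) (le_refl (c + 2))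
      calc k ≤ 2 * B ^ (c + 2) := hk.trans hp
        _ ≤ B * B ^ (c + 2) := Nat.mul_le_mul_right _ hB2
        _ = B ^ (c + 3) := by ring
    calc (N + 1) * k ≤ B ^ (c + 2) * B ^ (c + 3) := Nat.mul_le_mul h1 h2
      _ = B ^ (2 * c + 5) := by ring
      _ ≤ n ^ c₃ + c₃ := hfinal
  · -- factors are affine
    obtain ⟨ℓ₀, hℓ₀, rfl⟩ := Multiset.mem_map.mp hℓ
    exact totalDegree_scale_le_one _ (hdeg p.2 ℓ₀ hℓ₀)
  · -- factor counts
    rw [Multiset.card_map]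
    exact (hcard p.2).trans (vsbr_pbound_mono hcc₃ n)

/-! ### Matrix symmetry of homogeneous components -/

/-- Homogeneous components of a matrix-symmetric polynomial are matrix-symmetric. [folklore] -/
theorem rename_homogeneousComponent_matrixSymmetric {q : MvPolynomial (Fin n × Fin n) ℂ}
    (hq : ∀ σ τ : Equiv.Perm (Fin n), rename (fun p : Fin n × Fin n => (σ p.1, τ p.2)) q = q) (k : ℕ) :
    ∀ σ τ : Equiv.Perm (Fin n),
      rename (fun p : Fin n × Fin n => (σ p.1, τ p.2)) (homogeneousComponent k q) = homogeneousComponent k q := by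
  intro σ τ
  rw [rename_homogeneousComponent, hq σ τ]

/-! ### The reduction -/

/-- **A_∞ ⟺ A_∞ FOR HOMOGENEOUS POLYNOMIALS.**  The registered signature of `stub_sigmaPiSigmaValue` (left, verbatim) holds
iff for every exponent `c` there is one constant `c'` such that every HOMOGENEOUS matrix-symmetric member of
`PDClass 1 n c` (any level `n`) is `QPOrbitRestorable c' n`. [cite: Strassen1973, Satz 1] -/
theorem sigmaPiSigmaValue_iff_homogeneous :
    (∀ f : (n : ℕ) → MvPolynomial (Fin n × Fin n) ℂ, IsMatrixSymmetric f →
        (∃ c : ℕ, ∀ n : ℕ, PDClass (fun _ => 1) n c (f n)) →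
        ∃ c : ℕ, ∀ n : ℕ, QPOrbitRestorable c n (f n)) ↔
    (∀ c : ℕ, ∃ c' : ℕ, ∀ (n : ℕ) (q : MvPolynomial (Fin n × Fin n) ℂ),
        (∀ σ τ : Equiv.Perm (Fin n), MvPolynomial.rename (fun p : Fin n × Fin n => (σ p.1, τ p.2)) q = q) →
        (∃ d : ℕ, q.IsHomogeneous d) →
        PDClass (fun _ => 1) n c q → QPOrbitRestorable c' n q) := by
  rw [UniformForm.sigmaPiSigmaValue_iff_uniform]
  constructor
  · intro hU c
    obtain ⟨c', hc'⟩ := hU c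
    exact ⟨c', fun n q hs _ hpd => hc' n q hs hpd⟩
  · intro hH c
    obtain ⟨c₁, hc₁⟩ := exists_pdClass_one_homogeneousComponent c
    obtain ⟨c', hc'⟩ := hH c₁
    refine ⟨c' + 3, fun n q hs hpd => ?_⟩
    rw [← sum_homogeneousComponent q]
    exact ValueOrbit.qpOrbitRestorable_finset_sum _ _ fun k _ =>
      hc' n _ (rename_homogeneousComponent_matrixSymmetric hs k) ⟨k, homogeneousComponent_isHomogeneous k q⟩
        (hc₁ n q k hpd)

end HomogeneousReduction

end Summit.ValiantsHypothesis.ValiantsHypothesis.Theorems.OrbitRestorationQPDepthThreeRung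

end
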